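import Summits.HubbardSuperconductivity.HubbardSuperconductivity.Theses.FluxSpectroscopy
import Literature.MathematicalPhysics.QuantumLattice.HubbardTorusFluxBlochBound

/-!
# Route `FluxSpectroscopy`, support `BlochBound` (stmt-HubbardSuperconductivity-1821): proof

`Summit.HubbardSuperconductivity.HubbardSuperconductivity.Theses.FluxSpectroscopy.BlochBound`: for every
`U, δ, θ` and every side `L ≥ 1`, the flux envelope of the seam-twisted Hubbard torus obeys
`E^T_L(U,δ;θ) ≤ E^T_L(U,δ;0) + 2θ²`. The inline `ET` of the route file is `fluxEnergy L U δ θ` by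
`rfl` (`HubbardTorusFlux.lean`), and the bound is the Literature theorem
`fluxEnergy_le_fluxEnergy_zero_add_two_mul_sq` (`HubbardTorusFluxBlochBound.lean`: uniform-twist
gauge + `±` trick + `|⟨c†c⟩| ≤ 1` for `L ≥ 3`; seam pricing with `|⟨c†_p c_q⟩| ≤ 1/2` for `L = 1, 2`;
junk value `sInf ∅ = 0` on an empty sector).

Sources: D. Bohm, Phys. Rev. 75 (1949) 502; H. Watanabe, J. Stat. Phys. 177 (2019) 717 §2.2.1, §4.1;
Y. Tada, T. Koma, J. Stat. Phys. 165 (2016) 455 §4; Lieb–Schultz–Mattis, Ann. Phys. 16 (1961) 407.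
No definitions are introduced.
-/

namespace Summit.HubbardSuperconductivity.HubbardSuperconductivity.Theorems.FluxSpectroscopy

set_option linter.dupNamespace false -- summit = problem name (single-conjunct summit), D-0017

open Literature.MathematicalPhysics.QuantumLattice

/-- **`BlochBound` (item stmt-HubbardSuperconductivity-1821) holds**: for every `U, δ, θ` and
every `L ≥ 1`, `E^T_L(U,δ;θ) ≤ E^T_L(U,δ;0) + 2θ²` — the Bloch / Lieb–Schultz–Mattis calibration of
the flux envelope of route `FluxSpectroscopy`. Bohm (1949); Watanabe (2019) §2.2.1, §4.1;
Tada–Koma (2016) §4. -/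
theorem blochBound_proof :
    Summit.HubbardSuperconductivity.HubbardSuperconductivity.Theses.FluxSpectroscopy.BlochBound := by
  intro U δ θ L _
  exact fluxEnergy_le_fluxEnergy_zero_add_two_mul_sq U δ θ

end Summit.HubbardSuperconductivity.HubbardSuperconductivity.Theorems.FluxSpectroscopy
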